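import Summits.CriticalPhenomena.PercolationContinuityZ3.Theorems.PercRayRenewalTwoArmsRatioExponentFiniteSizeCriterion
import Summits.CriticalPhenomena.PercolationContinuityZ3.Theorems.PercRayRenewalAssembly

/-!
# Crux `PercRayRenewal.TwoArmsRatioExponent` (stmt-CriticalPhenomena-4625) — NORMAL FORMS of the
# finite-size criterion (FS), the single registered stub of line `registered` (skeleton v3)

Line lead prover-line-stmt-CriticalPhenomena-4625-c3-0 (cycle 3).  Bond percolation on `ℤ³` at
`p_c = criticalProbI 3` (`critBond`); `A₂(k, m) = twoClusterEvt k m`; `E(r)` = the pairs inside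
`Λ(r) = box 3 r`; `outer(s, n) = (· ∩ E(s)ᶜ) ⁻¹' A₂(s, n)` = two clusters of the `E(s)`-thinned
configuration restricted to `Λ(n)`, distinct inside `Λ(n)`, both meeting `Λ(s)` and `∂ⁱⁿΛ(n)`
(local notations `E⟦r⟧`, `outer⟦s, n⟧`, `FS`; no definitions).

The registered stub is
(FS) `∃ M ≥ 2, s₀ ≥ 1, c > 1, ∀ s ≥ s₀: P(outer(s, M s)) ≤ M^{-c}`.
This file shows that FS is a canonical statement — it has no preferred aspect ratio, no preferred
starting scale, and it is EQUIVALENT to the thinned two-arms ratio law: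

* `real_outer_le_of_fs`, `outerRatioLaw_of_finiteSizeCriterion` — **FS ⇒ T2'**: the thinned ratio
  law `P(outer(r, n)) ≤ C (r/n)^c` for all `1 ≤ r ≤ n` (same exponent, `C = M^c s₀^c`);
* `finiteSizeCriterion_of_outerRatioLaw` — **T2' ⇒ FS** (kernel copy of the lead-c2 bookkeeping
  lemma of `Cruxes/TwoArmsRatioExponent/Dominance.lean`, made importable); hence
  `finiteSizeCriterion_iff_outerRatioLaw` — **FS ⇔ T2'**;
* `finiteSizeCriterion_iff_eventually_lt_inv` — **FS ⇔ ∃ M ≥ 2, ∃ θ < 1/M, eventually in `s`,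
  `P(outer(s, M s)) ≤ θ`**: at ONE aspect ratio the thinned two-distinct-crossings probability is
  eventually below `1/M` by a margin (the form a Monte-Carlo test addresses: own MC j024157 gives
  `64 · P(outer(s, 64 s)) ≈ 0.87` at `s = 1, 2`);
* `finiteSizeCriterion_iff_eventually_aspect` — **FS ⇔ ∃ c > 1, for all large `M`, for ALL `s ≥ 1`,
  `P(outer(s, M s)) ≤ M^{-c}`**: the starting scale can be taken `s₀ = 1` and the aspect ratio
  arbitrary large;
* `twoArmsRatioExponent_of_finiteSizeCriterion` — FS ⇒ the crux (the skeleton's composition,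
  importable), and `percolationContinuityZ3_of_jumpWorld_finiteSizeCriterion` — with the PROVED
  `Assembly` (`percRayRenewalAssembly_proof`) the sub-problem needs FS only in the jump world
  `0 < θ(p_c)`, next to `JumpLineAvoidanceDecay`.

Sorry-free; no definitions; all statements are about the registered stub's event verbatim.
-/

namespace Summit.CriticalPhenomena.PercolationContinuityZ3.Theorems.TwoArmsRatioExponent

open MeasureTheory Filter Topology
open Literature.Probability.LatticeModels Literature.Probability.Percolation
open Summit.CriticalPhenomena.PercolationContinuityZ3.Theses
open Summit.CriticalPhenomena.PercolationContinuityZ3.Theorems.NearLinearTwoClusterDecay.Negative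

noncomputable section

set_option quotPrecheck false in
/-- `E⟦r⟧` — the pairs inside `Λ(r)`; a local notation, not a definition. -/
local notation "E⟦" r "⟧" => Set.sym2 (↑(box 3 r) : Set (Site 3))

set_option quotPrecheck false in
/-- `outer⟦s, n⟧` — the two-cluster event `A₂(s, n)` of the configuration thinned by `E⟦s⟧`; a
local notation, not a definition. -/
local notation "outer⟦" s ", " n "⟧" =>
  (fun ω : BondConfig (Site 3) => ω ∩ (Set.sym2 (↑(box 3 s) : Set (Site 3)))ᶜ) ⁻¹' twoClusterEvt s n

set_option quotPrecheck false in
/-- `FS` — the registered stub `stub_finiteSizeCriterion`, verbatim; a local notation, not a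
definition. -/
local notation "FS" =>
  (∃ M s₀ : ℕ, 2 ≤ M ∧ 1 ≤ s₀ ∧ ∃ c : ℝ, 1 < c ∧ ∀ s : ℕ, s₀ ≤ s →
    critBond.real ((fun ω : BondConfig (Site 3) => ω ∩ (Set.sym2 (↑(box 3 s) : Set (Site 3)))ᶜ) ⁻¹'
      twoClusterEvt s (M * s)) ≤ (M : ℝ) ^ (-c))

set_option quotPrecheck false in
/-- `T2'` — the thinned two-arms ratio law (the crux with `A₂` replaced by `outer ⊇ A₂`); a local
notation, not a definition. -/
local notation "T2'" =>
  (∃ c C : ℝ, 1 < c ∧ ∀ r n : ℕ, 1 ≤ r → r ≤ n →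
    critBond.real ((fun ω : BondConfig (Site 3) => ω ∩ (Set.sym2 (↑(box 3 r) : Set (Site 3)))ᶜ) ⁻¹'
      twoClusterEvt r n) ≤ C * ((r : ℝ) / n) ^ c)

/-! ## FS ⇒ the thinned ratio law T2' -/

/-- **The thinned ratio bound at integer scales**: under the FS data `M ≥ 2`, `s₀`, `c ≥ 0`, for
`1 ≤ r`, `s₀ ≤ r ≤ n`: `P(outer(r, n)) ≤ M^c · (r/n)^c` (with `k = ⌊log_M (n/r)⌋`:
`outer(r, n) ⊆ outer(r, M^k r)` by first exit, then the iterated product bound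
`real_outer_pow_le`, and `M^{-ck} ≤ M^c (r/n)^c`). [folklore] -/
theorem real_outer_le_of_fs {M s₀ : ℕ} (hM : 2 ≤ M) {c : ℝ} (hc : 0 ≤ c)
    (h : ∀ s : ℕ, s₀ ≤ s → critBond.real (outer⟦s, M * s⟧) ≤ (M : ℝ) ^ (-c))
    {r n : ℕ} (hr : 1 ≤ r) (hs₀r : s₀ ≤ r) (hrn : r ≤ n) :
    critBond.real (outer⟦r, n⟧) ≤ (M : ℝ) ^ c * ((r : ℝ) / n) ^ c := by
  have hM1 : 1 ≤ M := le_trans (by norm_num) hM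
  have hM1' : 1 < M := lt_of_lt_of_le (by norm_num) hM
  have hMpos : (0 : ℝ) < M := by exact_mod_cast (lt_of_lt_of_le (by norm_num) hM : 0 < M)
  have hr0 : 0 < r := hr
  have hn0 : 0 < n := lt_of_lt_of_le hr0 hrn
  have hnR : (0 : ℝ) < n := by exact_mod_cast hn0
  set k := Nat.log M (n / r) with hk
  have hq0 : n / r ≠ 0 := by
    have : 1 ≤ n / r := (Nat.le_div_iff_mul_le hr0).2 (by simpa using hrn)
    omega
  have hlow : M ^ k * r ≤ n :=
    (Nat.le_div_iff_mul_le hr0).1 (Nat.pow_log_le_self M hq0)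
  have hupp : n < M ^ (k + 1) * r :=
    (Nat.div_lt_iff_lt_mul hr0).1 (Nat.lt_pow_succ_log_self hM1' (n / r))
  have hrMk : r ≤ M ^ k * r := Nat.le_mul_of_pos_left r (pow_pos (by omega) k)
  -- P(outer(r,n)) ≤ P(outer(r, M^k r)) ≤ θ^k
  have h1 : critBond.real (outer⟦r, n⟧) ≤ critBond.real (outer⟦r, M ^ k * r⟧) :=
    DCT16.real_mono_of_forall_subset_edgeSet _ _ fun ω hω hmem => outer_anti hrMk hlow hω hmem
  have hθ0 : 0 ≤ (M : ℝ) ^ (-c) := Real.rpow_nonneg hMpos.le _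
  have h3 : critBond.real (outer⟦r, M ^ k * r⟧) ≤ ((M : ℝ) ^ (-c)) ^ k :=
    real_outer_pow_le hM1 hθ0 h k r hs₀r
  set t : ℝ := (M : ℝ) ^ (k : ℕ) with ht
  have htpos : 0 < t := pow_pos hMpos k
  have hθk : ((M : ℝ) ^ (-c)) ^ k = t ^ (-c) := by
    rw [ht, ← Real.rpow_natCast ((M : ℝ) ^ (-c)) k, ← Real.rpow_mul hMpos.le,
      ← Real.rpow_natCast (M : ℝ) k, ← Real.rpow_mul hMpos.le, mul_comm]
  have hkey : t⁻¹ ≤ (M : ℝ) * ((r : ℝ) / n) := by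
    have hupp' : (n : ℝ) < (M : ℝ) ^ (k + 1) * r := by exact_mod_cast hupp
    rw [inv_le_iff_one_le_mul₀ htpos]
    have : (n : ℝ) ≤ t * ((M : ℝ) * r) := by
      rw [ht]; nlinarith [hupp', pow_succ (M : ℝ) k]
    calc (1 : ℝ) = (n : ℝ) / n := (div_self hnR.ne').symm
      _ ≤ t * ((M : ℝ) * r) / n := div_le_div_of_nonneg_right this hnR.le
      _ = (M : ℝ) * ((r : ℝ) / n) * t := by ring
  calc critBond.real (outer⟦r, n⟧) ≤ t ^ (-c) := by
        calc critBond.real (outer⟦r, n⟧) ≤ ((M : ℝ) ^ (-c)) ^ k := h1.trans h3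
          _ = t ^ (-c) := hθk
    _ = (t⁻¹) ^ c := by rw [Real.rpow_neg htpos.le, Real.inv_rpow htpos.le]
    _ ≤ ((M : ℝ) * ((r : ℝ) / n)) ^ c := Real.rpow_le_rpow (inv_nonneg.2 htpos.le) hkey hc
    _ = (M : ℝ) ^ c * ((r : ℝ) / n) ^ c := Real.mul_rpow hMpos.le (by positivity)

/-- **FS ⇒ T2' (the thinned two-arms ratio law)**, with the same exponent `c` and
`C = M^c s₀^c`: scales `r < s₀` are absorbed by the monotonicity of `outer(·, n)` in the inner
radius (`outer_subset_outer`), and `n < s₀` by `P ≤ 1`. [folklore] -/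
theorem outerRatioLaw_of_finiteSizeCriterion (hFS : FS) : T2' := by
  obtain ⟨M, s₀, hM, hs₀, c, hc, h⟩ := hFS
  have hc0 : 0 ≤ c := le_trans zero_le_one hc.le
  have hMpos : (0 : ℝ) < M := by exact_mod_cast (lt_of_lt_of_le (by norm_num) hM : 0 < M)
  have hs₀R : (1 : ℝ) ≤ s₀ := by exact_mod_cast hs₀
  refine ⟨c, (M : ℝ) ^ c * (s₀ : ℝ) ^ c, hc, fun r n hr hrn => ?_⟩
  have hnR : (0 : ℝ) < n := by exact_mod_cast (lt_of_lt_of_le hr hrn)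
  have hρ0 : 0 ≤ (r : ℝ) / n := by positivity
  have hMc : 0 ≤ (M : ℝ) ^ c := Real.rpow_nonneg hMpos.le c
  have hs₀c : 1 ≤ (s₀ : ℝ) ^ c := Real.one_le_rpow hs₀R hc0
  by_cases hsr : s₀ ≤ r
  · calc critBond.real (outer⟦r, n⟧) ≤ (M : ℝ) ^ c * ((r : ℝ) / n) ^ c :=
          real_outer_le_of_fs hM hc0 h hr hsr hrn
      _ = (M : ℝ) ^ c * 1 * ((r : ℝ) / n) ^ c := by ring
      _ ≤ (M : ℝ) ^ c * (s₀ : ℝ) ^ c * ((r : ℝ) / n) ^ c :=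
          mul_le_mul_of_nonneg_right (mul_le_mul_of_nonneg_left hs₀c hMc) (Real.rpow_nonneg hρ0 c)
  · push Not at hsr
    by_cases hsn : s₀ ≤ n
    · have hmono : critBond.real (outer⟦r, n⟧) ≤ critBond.real (outer⟦s₀, n⟧) :=
        measureReal_mono (outer_subset_outer hsr.le n)
      have hbig := real_outer_le_of_fs hM hc0 h hs₀ le_rfl hsn
      have hcmp : ((s₀ : ℝ) / n) ^ c ≤ (s₀ : ℝ) ^ c * ((r : ℝ) / n) ^ c := by
        rw [← Real.mul_rpow (by positivity) hρ0]
        refine Real.rpow_le_rpow (by positivity) ?_ hc0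
        rw [mul_div_assoc']
        refine div_le_div_of_nonneg_right ?_ hnR.le
        have : (1 : ℝ) ≤ r := by exact_mod_cast hr
        nlinarith
      calc critBond.real (outer⟦r, n⟧) ≤ (M : ℝ) ^ c * ((s₀ : ℝ) / n) ^ c := hmono.trans hbig
        _ ≤ (M : ℝ) ^ c * ((s₀ : ℝ) ^ c * ((r : ℝ) / n) ^ c) := mul_le_mul_of_nonneg_left hcmp hMc
        _ = (M : ℝ) ^ c * (s₀ : ℝ) ^ c * ((r : ℝ) / n) ^ c := by ring
    · push Not at hsn
      have hP1 : critBond.real (outer⟦r, n⟧) ≤ 1 := measureReal_le_one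
      have hcmp : (1 : ℝ) ≤ (s₀ : ℝ) ^ c * ((r : ℝ) / n) ^ c := by
        rw [← Real.mul_rpow (by positivity) hρ0]
        refine Real.one_le_rpow ?_ hc0
        rw [mul_div_assoc', le_div_iff₀ hnR, one_mul]
        have h1 : (n : ℝ) ≤ s₀ := by exact_mod_cast hsn.le
        have h2 : (1 : ℝ) ≤ r := by exact_mod_cast hr
        nlinarith
      have hM1 : (1 : ℝ) ≤ (M : ℝ) ^ c :=
        Real.one_le_rpow (by exact_mod_cast le_trans (by norm_num) hM) hc0
      calc critBond.real (outer⟦r, n⟧) ≤ 1 := hP1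
        _ ≤ (M : ℝ) ^ c * ((s₀ : ℝ) ^ c * ((r : ℝ) / n) ^ c) := by nlinarith
        _ = (M : ℝ) ^ c * (s₀ : ℝ) ^ c * ((r : ℝ) / n) ^ c := by ring

/-! ## T2' ⇒ FS, hence FS ⇔ T2' -/

/-- **T2' ⇒ FS**: from `P(outer(r, n)) ≤ C (r/n)^c`, `c > 1`, take `c' = (1+c)/2` and an integer
`M ≥ 2` with `max C 1 ≤ M^{c-c'}`; then `P(outer(s, M s)) ≤ C M^{-c} ≤ M^{-c'}` for all `s ≥ 1`.
(Kernel copy of `fs_of_outerRatioLaw` of the lead-c2 workfile `Cruxes/…/Dominance.lean`.)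
[folklore] -/
theorem finiteSizeCriterion_of_outerRatioLaw (h : T2') : FS := by
  obtain ⟨c, C, hc, hP⟩ := h
  set c' : ℝ := (1 + c) / 2 with hc'
  have hc'1 : 1 < c' := by rw [hc']; linarith
  have hδ : 0 < c - c' := by rw [hc']; linarith
  obtain ⟨M, hMge⟩ := exists_nat_ge (max 2 ((max C 1) ^ (1 / (c - c'))))
  have hM2R : (2 : ℝ) ≤ M := le_trans (le_max_left _ _) hMge
  have hM2 : 2 ≤ M := by exact_mod_cast hM2R
  have hMpos : (0 : ℝ) < M := by linarith
  have hCM : max C 1 ≤ (M : ℝ) ^ (c - c') := by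
    have h1 : (max C 1) ^ (1 / (c - c')) ≤ (M : ℝ) := le_trans (le_max_right _ _) hMge
    have h0 : 0 ≤ max C 1 := le_trans zero_le_one (le_max_right _ _)
    calc max C 1 = ((max C 1) ^ (1 / (c - c'))) ^ (c - c') := by
          rw [← Real.rpow_mul h0, one_div, inv_mul_cancel₀ hδ.ne', Real.rpow_one]
      _ ≤ (M : ℝ) ^ (c - c') := Real.rpow_le_rpow (Real.rpow_nonneg h0 _) h1 hδ.le
  refine ⟨M, 1, hM2, le_rfl, c', hc'1, fun s hs => ?_⟩
  have hsMs : s ≤ M * s := Nat.le_mul_of_pos_left s (by omega)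
  have hmain := hP s (M * s) hs hsMs
  have hratio : ((s : ℝ) / ((M * s : ℕ) : ℝ)) = (M : ℝ)⁻¹ := by
    have hs0 : (0 : ℝ) < s := by exact_mod_cast hs
    rw [Nat.cast_mul]; field_simp
  rw [hratio, Real.inv_rpow hMpos.le] at hmain
  have hC1 : C ≤ (M : ℝ) ^ (c - c') := le_trans (le_max_left _ _) hCM
  calc critBond.real (outer⟦s, M * s⟧) ≤ C * ((M : ℝ) ^ c)⁻¹ := hmain
    _ ≤ (M : ℝ) ^ (c - c') * ((M : ℝ) ^ c)⁻¹ :=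
        mul_le_mul_of_nonneg_right hC1 (inv_nonneg.2 (Real.rpow_nonneg hMpos.le c))
    _ = (M : ℝ) ^ (-c') := by
        rw [← Real.rpow_neg hMpos.le, ← Real.rpow_add hMpos]
        congr 1; ring

/-- **FS ⇔ T2'**: the finite-size criterion at one aspect ratio is EQUIVALENT to the thinned
two-arms ratio law for all `1 ≤ r ≤ n` — FS is the crux for the thinned event `outer ⊇ A₂`
(numerically `P(outer)/P(A₂) ≈ 1.25`, own MC j024157). [folklore] -/
theorem finiteSizeCriterion_iff_outerRatioLaw : (∃ M s₀ : ℕ, 2 ≤ M ∧ 1 ≤ s₀ ∧ ∃ c : ℝ, 1 < c ∧ ∀ s : ℕ, s₀ ≤ s → critBond.real ((fun ω : BondConfig (Site 3) => ω ∩ (Set.sym2 (↑(box 3 s) : Set (Site 3)))ᶜ) ⁻¹' twoClusterEvt s (M * s)) ≤ (M : ℝ) ^ (-c)) ↔ (∃ c C : ℝ, 1 < c ∧ ∀ r n : ℕ, 1 ≤ r → r ≤ n → critBond.real ((fun ω : BondConfig (Site 3) => ω ∩ (Set.sym2 (↑(box 3 r) : Set (Site 3)))ᶜ) ⁻¹'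 twoClusterEvt r n) ≤ C * ((r : ℝ) / n) ^ c) :=
  ⟨outerRatioLaw_of_finiteSizeCriterion, finiteSizeCriterion_of_outerRatioLaw⟩

/-! ## No preferred aspect ratio, no preferred starting scale -/

/-- **FS ⇔ eventual margin below `1/M` at one aspect ratio**: FS holds iff for some `M ≥ 2` and
some `θ < 1/M`, `P(outer(s, M s)) ≤ θ` for all large `s` (`θ = M^{-c}` one way; the other way
`c = -log θ / log M > 1` when `θ > 0`, any `c` when `θ ≤ 0`). [folklore] -/
theorem finiteSizeCriterion_iff_eventually_lt_inv :
    FS ↔ ∃ M : ℕ, 2 ≤ M ∧ ∃ θ : ℝ, θ < (M : ℝ)⁻¹ ∧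
      ∀ᶠ s : ℕ in atTop, critBond.real (outer⟦s, M * s⟧) ≤ θ := by
  constructor
  · rintro ⟨M, s₀, hM, -, c, hc, h⟩
    have hM1 : (1 : ℝ) < M := by exact_mod_cast (lt_of_lt_of_le (by norm_num) hM : 1 < M)
    have hMpos : (0 : ℝ) < M := by linarith
    refine ⟨M, hM, (M : ℝ) ^ (-c), ?_, ?_⟩
    · rw [← Real.rpow_neg_one]
      exact Real.rpow_lt_rpow_of_exponent_lt hM1 (by linarith)
    · filter_upwards [eventually_ge_atTop s₀] with s hs using h s hs
  · rintro ⟨M, hM, θ, hθ, hev⟩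
    have hM1 : (1 : ℝ) < M := by exact_mod_cast (lt_of_lt_of_le (by norm_num) hM : 1 < M)
    have hMpos : (0 : ℝ) < M := by linarith
    obtain ⟨s₁, hs₁⟩ := eventually_atTop.1 hev
    by_cases hθ0 : θ ≤ 0
    · -- probabilities ≤ θ ≤ 0: any exponent works
      refine ⟨M, max s₁ 1, hM, le_max_right _ _, 2, by norm_num, fun s hs => ?_⟩
      exact ((hs₁ s (le_trans (le_max_left _ _) hs)).trans hθ0).trans (Real.rpow_nonneg hMpos.le _)
    · push Not at hθ0
      have hlogM : 0 < Real.log M := Real.log_pos hM1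
      have hθ1 : θ < 1 := hθ.trans_le (inv_le_one_of_one_le₀ hM1.le)
      set c : ℝ := -Real.log θ / Real.log M with hcdef
      have hc1 : 1 < c := by
        rw [hcdef, lt_div_iff₀ hlogM, one_mul, lt_neg, ← Real.log_inv]
        exact Real.log_lt_log hθ0 hθ
      have hMc : (M : ℝ) ^ (-c) = θ := by
        rw [Real.rpow_def_of_pos hMpos, hcdef]
        have : Real.log M * -(-Real.log θ / Real.log M) = Real.log θ := by field_simp
        rw [this, Real.exp_log hθ0]
      refine ⟨M, max s₁ 1, hM, le_max_right _ _, c, hc1, fun s hs => ?_⟩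
      rw [hMc]
      exact hs₁ s (le_trans (le_max_left _ _) hs)

/-- **FS ⇔ the bound holds at EVERY large aspect ratio, from the unit scale on**: FS holds iff there
is `c > 1` such that for all large `M`, for all `s ≥ 1`, `P(outer(s, M s)) ≤ M^{-c}` (through T2':
`P(outer(s, Ms)) ≤ C M^{-c₀} ≤ M^{-c}` once `max C 1 ≤ M^{c₀ - c}`, `c = (1 + c₀)/2`). [folklore] -/
theorem finiteSizeCriterion_iff_eventually_aspect :
    FS ↔ ∃ c : ℝ, 1 < c ∧ ∀ᶠ M : ℕ in atTop, ∀ s : ℕ, 1 ≤ s →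
      critBond.real (outer⟦s, M * s⟧) ≤ (M : ℝ) ^ (-c) := by
  constructor
  · intro hFS
    obtain ⟨c, C, hc, hP⟩ := outerRatioLaw_of_finiteSizeCriterion hFS
    set c' : ℝ := (1 + c) / 2 with hc'
    have hc'1 : 1 < c' := by rw [hc']; linarith
    have hδ : 0 < c - c' := by rw [hc']; linarith
    refine ⟨c', hc'1, ?_⟩
    filter_upwards [eventually_ge_atTop (max 2 ⌈(max C 1) ^ (1 / (c - c'))⌉₊)] with M hMge
    have hM2 : 2 ≤ M := le_trans (le_max_left _ _) hMge
    have hMpos : (0 : ℝ) < M := by exact_mod_cast (lt_of_lt_of_le (by norm_num) hM2 : 0 < M)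
    have hCM : max C 1 ≤ (M : ℝ) ^ (c - c') := by
      have h1 : (max C 1) ^ (1 / (c - c')) ≤ (M : ℝ) :=
        le_trans (Nat.le_ceil _) (by exact_mod_cast le_trans (le_max_right _ _) hMge)
      have h0 : 0 ≤ max C 1 := le_trans zero_le_one (le_max_right _ _)
      calc max C 1 = ((max C 1) ^ (1 / (c - c'))) ^ (c - c') := by
            rw [← Real.rpow_mul h0, one_div, inv_mul_cancel₀ hδ.ne', Real.rpow_one]
        _ ≤ (M : ℝ) ^ (c - c') := Real.rpow_le_rpow (Real.rpow_nonneg h0 _) h1 hδ.le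
    intro s hs
    have hsMs : s ≤ M * s := Nat.le_mul_of_pos_left s (by omega)
    have hmain := hP s (M * s) hs hsMs
    have hratio : ((s : ℝ) / ((M * s : ℕ) : ℝ)) = (M : ℝ)⁻¹ := by
      have hs0 : (0 : ℝ) < s := by exact_mod_cast hs
      rw [Nat.cast_mul]; field_simp
    rw [hratio, Real.inv_rpow hMpos.le] at hmain
    have hC1 : C ≤ (M : ℝ) ^ (c - c') := le_trans (le_max_left _ _) hCM
    calc critBond.real (outer⟦s, M * s⟧) ≤ C * ((M : ℝ) ^ c)⁻¹ := hmain
      _ ≤ (M : ℝ) ^ (c - c') * ((M : ℝ) ^ c)⁻¹ :=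
          mul_le_mul_of_nonneg_right hC1 (inv_nonneg.2 (Real.rpow_nonneg hMpos.le c))
      _ = (M : ℝ) ^ (-c') := by
          rw [← Real.rpow_neg hMpos.le, ← Real.rpow_add hMpos]
          congr 1; ring
  · rintro ⟨c, hc, hev⟩
    obtain ⟨M₀, hM₀⟩ := eventually_atTop.1 hev
    refine ⟨max M₀ 2, 1, le_max_right _ _, le_rfl, c, hc, fun s hs => ?_⟩
    exact hM₀ (max M₀ 2) (le_max_left _ _) s hs

/-! ## What FS buys: the crux, and — with the proved Assembly — the sub-problem in the jump world -/

/-- **FS ⇒ the crux `TwoArmsRatioExponent`** (the skeleton's composition, importable):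
`ratioLaw_of_finiteSizeCriterion` plus the event identity `setOf_stubEvt_eq_twoClusterEvt`.
[folklore] -/
theorem twoArmsRatioExponent_of_finiteSizeCriterion (hFS : FS) :
    PercRayRenewal.TwoArmsRatioExponent := by
  obtain ⟨c, C, hc, h⟩ := ratioLaw_of_finiteSizeCriterion hFS
  unfold PercRayRenewal.TwoArmsRatioExponent
  refine ⟨c, C, hc, fun r n hr hrn => ?_⟩
  rw [setOf_stubEvt_eq_twoClusterEvt]
  exact h r n hr hrn

/-- **Jump-world FS and `JumpLineAvoidanceDecay` already give the sub-problem**, by the PROVED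
`Assembly` of route `PercRayRenewal` (`percRayRenewalAssembly_proof`): if `θ(p_c) ≠ 0` then
`θ(p_c) > 0`, so FS holds, hence the crux, and the Assembly yields `θ(p_c) = 0`. So the crux is
needed only in its (vacuous-if-true-summit) jump-world form. [folklore] -/
theorem percolationContinuityZ3_of_jumpWorld_finiteSizeCriterion
    (hFSj : 0 < theta (zdGraph 3) (0 : Site 3) (criticalProbI 3) → FS)
    (hG : PercRayRenewal.JumpLineAvoidanceDecay) : _root_.PercolationContinuityZ3 := by
  by_contra hcon
  have hne : theta (zdGraph 3) (0 : Site 3) (criticalProbI 3) ≠ 0 := fun h0 =>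
    hcon (Literature.Probability.Percolation.percolationContinuityZ3_iff.2 h0)
  have hθ : 0 < theta (zdGraph 3) (0 : Site 3) (criticalProbI 3) :=
    lt_of_le_of_ne (by unfold theta; exact measureReal_nonneg) (Ne.symm hne)
  exact hcon (percRayRenewalAssembly_proof (twoArmsRatioExponent_of_finiteSizeCriterion (hFSj hθ)) hG)

end

end Summit.CriticalPhenomena.PercolationContinuityZ3.Theorems.TwoArmsRatioExponent
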